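import Mathlib
import HarnessLib
import HarnessLib.Audit
import Summits.SmoothPoincare4.Statement
import Summits.SmoothPoincare4.SmoothPoincare4.Theses.RootDecompY
import Literature.Topology.FourManifolds.ConnectedSum
import Literature.Topology.FourManifolds.ComplexProjectiveSpace
import Literature.Topology.FourManifolds.ComplexProjectiveSpaceOrientationProofs
import Literature.Topology.FourManifolds.ChartTransport
import Literature.Topology.FourManifolds.ConnectedSumData
import Literature.Topology.FourManifolds.OrientedConnectedSumExistence
import Literature.Topology.FourManifolds.OrientedConnectedSumUniqueness
import Literature.Topology.FourManifolds.OrientedConnectedSumTransportProofs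
import Literature.Topology.FourManifolds.SpinDiffeomorphProofs
import Literature.Topology.FourManifolds.SmoothOrientationDiffeomorphProofs
import Literature.Topology.FourManifolds.SmoothOrientationConnectedProofs
import Literature.Topology.FourManifolds.ConnectedSumTransportProofs
import Literature.Topology.FourManifolds.HomotopyS4OrientableProofs
import Literature.Topology.FourManifolds.HomotopyS4CompactProofs
import Literature.Topology.FourManifolds.ConnectedSumSphereIdentity
import Literature.Topology.FourManifolds.ConnectedSumSpheres
import Literature.Topology.FourManifolds.ConnectedSumExistence
import Literature.Topology.FourManifolds.CircleProdSumAdditivity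

/-! # RootDecompY — the split glue `TwoStepDescentParityGlue` (item stmt-SmoothPoincare4-31191) PROVED.

`TwoStepDescentParityGlue : TwistedDescent → DefiniteTwoStepDescent → TwoStepDescent` (route Y,
`--split TwoStepDescent --into TwistedDescent DefiniteTwoStepDescent`).  The glue is a theorem: the parity dichotomy of
the final host.  Given orientation-free two-step data whose host `R` is a connected sum of `ℂℙ²` with `ℂℙ²`, fix an
orientation `c₀` of `ℂℙ²` (`isOrientable_complexProjectivePlane_holds`); an unoriented connected sum of oriented manifolds
is an oriented connected sum `(ℂℙ², c₀) # (ℂℙ², c')` with `c' = c₀` (definite host: `DefiniteTwoStepDescent` applies) or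
`c' = -c₀` (odd host: `TwistedDescent` applies) — Kosinski 1993 VI (1.1), Kervaire–Milnor 1963 §2.  That upgrade lemma is the
PROVED tree theorem `Literature.Topology.FourManifolds.IsConnectedSum.exists_isOrientedConnectedSum`
(`Literature/Topology/FourManifolds/CircleProdSumAdditivity.lean` l.116), IMPORTED and used by name (the writer's g5 text
transcribed it while that module was unbuilt on the farm; the gate's `dedup.landed` lint now reports it landed and importable).
Text = lens-6 v8 `split/TreeLink.lean` (`twoStepDescent_of_parity`), re-based on the born route file. -/

noncomputable section

set_option linter.dupNamespace false

namespace Summit.SmoothPoincare4.SmoothPoincare4.Theorems.RootDecompYTwoStepDescentParitySplit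

open scoped Manifold ContDiff Topology
open Set Function
open Literature.Topology.FourManifolds
open Summit.SmoothPoincare4.SmoothPoincare4.Theses.RootDecompY

/-- The split glue of route Y at `TwoStepDescent` holds outright (parity dichotomy of the final host). -/
theorem twoStepDescentParityGlue_holds : TwoStepDescentParityGlue := by
  intro hT hD M _ _ _ _ _ e hdata
  obtain ⟨P₁, P₂, R, t₁, h₁, s₁, ch₁, m₁, t₂, h₂, s₂, ch₂, m₂, tR, hR, sR, chR, mR, hMP, hPP, hRR, hdiff⟩ :=
    hdata
  obtain ⟨c₀⟩ : Nonempty (SmoothOrientation (𝓡 4) ComplexProjectivePlane) :=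
    isOrientable_complexProjectivePlane_holds
  obtain ⟨c', oR, hc', hor⟩ := IsConnectedSum.exists_isOrientedConnectedSum (n := 4) (by norm_num) hRR c₀ c₀
  rcases hc' with hc | hc
  · rw [hc] at hor
    exact hD M e ⟨P₁, P₂, R, t₁, h₁, s₁, ch₁, m₁, t₂, h₂, s₂, ch₂, m₂, tR, hR, sR, chR, mR, hMP, hPP,
      ⟨c₀, oR, hor⟩, hdiff⟩
  · rw [hc] at hor
    exact hT M e ⟨P₁, P₂, R, t₁, h₁, s₁, ch₁, m₁, t₂, h₂, s₂, ch₂, m₂, tR, hR, sR, chR, mR, hMP, hPP,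
      ⟨c₀, oR, hor⟩, hdiff⟩

end Summit.SmoothPoincare4.SmoothPoincare4.Theorems.RootDecompYTwoStepDescentParitySplit

end
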